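import Literature.MathematicalPhysics.QuantumFieldTheory.Balaban1983to89.B9Thm39CinvSumsY
import Literature.MathematicalPhysics.QuantumFieldTheory.Balaban1983to89.B9Thm39CinvSandwichQ

/-!
# `Balaban1983to89.B9Thm39CinvTorusRegularFinal` — [Balaban1985BackgroundPropagators] THEOREM 3.9 pp. 411–413 ⇒ THEOREM 3.2 (3.48) p. 398 FOR
# `C(U) = (Q′G′²Q′*)⁻¹(U)` AT A GENERAL (REGULAR) CONFIGURATION, AT def-Y's CARRIERS: THE ASSEMBLY — FILE 1's glue fed with the three sums of FILE 5b and
# the `Q′( · )Q′*` sandwich of FILE 3b, every remaining input a PER-CUBE displayed block or a located geometric fact (cell `lit-balaban`, G-B9-LETTERS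
# module M5.6 FILE 6, seat p21 gen 32)

statement-level skeleton of published theorems with citation tags; proofs where landed; nothing here is a claim about the Yang–Mills mass gap

CITATION HEADER (lean-in-tree rule).  B9 = T. Bałaban, *Propagators for lattice gauge theories in a background field*, Commun. Math. Phys. **99** (1985)
389–434 (journal page = PDF page + 388; held `paper:balaban1985-cmp99-background-propagators`, pp. 408–414 re-read by this seat 2026-08-28).  p. 409 (3.87)
«C₀ = Σ_{□∈𝒟} h_□C_□h_□», «The operators constructed for this sequence, which we denote by G′_□(U), C_□(U) = (Q′(U)G′²_□(U)Q′*(U))⁻¹, G_□(U), satisfy all the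
inequalities of Theorems 3.1–3.3»; p. 411 (3.95)–(3.96) «Q′G′²Q′*C₀ = I − R … the operator R is small and (Q′G′²Q′*)⁻¹ = C₀(I − R)⁻¹ = Σ C₀Rⁿ.  The series is
convergent in the weighted supremum norm on 𝔅 appearing in the inequality (3.48)»; p. 413 Theorem 3.9 «For M sufficiently large, and a configuration U
satisfying (3.35) … This theorem implies Theorem 3.2»; p. 398 Theorem 3.2 (3.48) «|(Q′(U)G′²(U)Q′*(U))⁻¹(y, y′)| ≦ B₀(Lʲη)⁻⁴(L^{j′}η)^{−d}e^{−δ₀d(y,y′)}».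
[4] = [Balaban1984PropagatorsII] Lemma 2.1 p. 234, (2.51)–(2.54) pp. 232–233, (2.66) p. 234, (2.83)–(2.87) pp. 237–238.  Rows B9.Thm3.9 × B9.Thm3.2 ×
B9.Eq3.95 × B9.Eq3.96 × B9.Eq3.87 (cells only; no row head changes).

WHY THIS FILE / WHAT IS ASSEMBLED.  FILE 1 (`hasMajorant_conj_Cinv_of_cubes`): (3.95) + `T·L = 1` + per-cube (3.48) blocks + three displayed sum majorants
⟹ (3.48)-shape majorant of `conj b (s•T)`.  FILE 5b: the three sum majorants from per-cube displayed data.  FILE 3b: the upper majorant of `L = Q′G′²Q′*`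
from the site majorant of `η⁴G′²`.  THIS FILE composes them:
* §1 ★★ `hasMajorant_conj_Cinv_final` — for ℝ-linear block letters `L`, `T` (`T·L = 1`), local letters `L_□`, `C_□`, block cut-offs `h_□` (`Σh_□² = 1`,
  `|h_□| ≦ 1`, `supp h_□ ⊂ S_□`, overlap `≦ N`, slowly varying: `|h_□(t′) − h_□(t)| ≦ ℓ₀ + ℓ₁d`), characteristic cut-offs `χ_□` (`0 ≦ χ_□ ≦ 1`, `= 1`
  over `S^χ_□`, separated from `supp h_□`: `d(a, a″) ≧ D_sep` for `a ∉ S^χ_□`, `a″ ∈ S_□`), the local inverse property `M_{h_□}(χ_□L_□)C_□M_{h_□} = M²_{h_□}`,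
  per-cube (3.48) blocks `hC` (`1_{S_□}B₀P(a)e^{−bδ₀d}` of `conj b (s•C_□)`), upper majorants `hL`/`hLloc` (`κP⁻¹e^{−a_Lδ₀d}` of `conj b (s′•L)`,
  `conj b (s′•L_□)`), the [2]-difference majorants `hD` (DISPLAYED, GAP G-B9-05), scale transfer for `P`, (2.54), symmetry, [4] Lemma 2.1 at `(δ₀, b−ρ)` and
  at `(ρδ₀, α′)`, the exponent splits, and the LOCATED smallness `(θ₁+θ₂+θ₃)c₁(ρδ₀, α′) < 1` («M sufficiently large»): `conj b (s•T)` has the majorant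
  `N·B₀·c₁(ρδ₀, α′)(1 − (θ₁+θ₂+θ₃)c₁)⁻¹·P(a)·e^{−(1−α′)ρδ₀·d(a,a′)}` with `θ₁ = Nκ B₀Cc₁(δ₀,b−ρ)e^{−a_sepδ₀D_sep}`, `θ₂ = Nκ_De^{−2δ₀D_sep}B₀Cc₁(δ₀,b−ρ)`,
  `θ₃ = N(ℓ₀ + ℓ₁(α_cδ₀)⁻¹)κB₀Cc₁(δ₀,b−ρ)` (equation hypotheses `hθ₁`, `hθ₂`, `hθ₃`).
* §2 ★★ `norm_Cinv_apply_final` — (3.48)'s PRINTED SHAPE pointwise: for a source supported at one block `s′` with `‖λ(s′)‖ ≦ 1`,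
  `s·‖(Tλ)(t)‖ ≦ (Σ_j‖b_j‖)M₂·[N B₀c₁(1 − θc₁)⁻¹]·P(ιB t)·e^{−(1−α′)ρδ₀·d(ιB t, ιB s′)}` (FILE 1 §5's reading BY NAME).
* §3 AT def-Y's LETTERS: `restrictScalars_XinvY_mul_XY` (`XinvY·XY = 1` from `IsUnit XY`, real scalars); ★★ `hasMajorant_conj_XinvY_final` — §1 with
  `L := XY i parS G′ U`, `T := XinvY i parS G′ U`, `L_□ := XY i parS G′_□ U` and the upper majorants `hL`/`hLloc` DISCHARGED by FILE 3b from SITE majorants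
  `hGG`/`hGGc` of `conj b (s′•(G′·G′))`, `conj b (s′•(G′_□·G′_□))` (M5.5's (3.42)₁ + FILE 3a shapes) at contractive transporters.

HONEST SCOPE / NOT CLAIMED.  Exactly FILE 1's scope: sup-entry (3.48) only; the per-cube (3.48) blocks `hC` of the `C_□` (Cor. 3.6 via the cube letters —
M5.2-E), the local inverse property `hloc` ((3.87) «C_□ = (Q′G′²_□Q′*)⁻¹» where `h_□` lives), the [2]-difference majorant `hD` (GAP G-B9-05 — NOT derived
in the tree), the slow variation `hLip` of the block cut-offs in `d` (GAPS G-pv08-1), the separation `hsep` of the cube cover, the site majorants of `G′²`,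
`G′_□²` (M5.5 ★★ + FILE 3a) and the geometry (scale transfer of `P = ℓ⁻⁴`, [4] Lemma 2.1 for the member — M5.5 FILE 1 `geo_inputs_geo9K` above its
threshold) are DISPLAYED hypotheses of the printed shape; the smallness is located, not derived from a numerical `M`.  Theorem 3.9's walk expansion (3.98)
and its locality clause are not reproduced ((3.96)'s fixed-point form suffices for (3.48)).  Finite 𝕋 member of the k-level V1 family; constants explicit;
nothing continuum, nothing about the mass gap; NOT summit progress.  RELATED, NOT DUPLICATED: FILES 1/2/3a/3b/5a/5b of the module (USED BY NAME), r06's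
`B9Thm39Whole.conv348_of_local348` (scalar identity-block-map glue for the leaf `B9.Thm39Printed`), dag-n06-j/w1 `B9Thm32SiteCVariationalY` (the variational
road to (3.48) in cell pub-ymgap — a different proof).
-/

noncomputable section

namespace Literature.MathematicalPhysics.QuantumFieldTheory.Balaban1983to89.B9Thm39CinvTorusRegularFinal

open Node00
open B6KLevelCensusIndexV1 (KIdx)
open B6RandomWalk (HasMajorant Triangle254 Ineq261 Ineq263 hasMajorant_mono)
open B9Thm34Ext (toB6)
open B9GeoNormsKLevelV1 (geo9K)
open B9Eq352DivFormLetters (conj)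
open B9Thm37CubeCoverCommutators (cutMulY)
open B9Thm39CinvTorusRegular (hasMajorant_conj_Cinv_of_cubes norm_apply_le_of_hasMajorant_blk)
open B9Thm39CinvSumsY (hR₁_of_cubes hR₂_of_cubes hR₃_of_cubes)
open B9Thm39CinvSandwichQ (hasMajorant_conj_XY_of_site)

variable {d ℓ : ℕ} {hd : 1 ≤ d + 1} {hL : Odd (ℓ + 1) ∧ 1 < ℓ + 1} {b₀ b₁ : ℝ}
variable {𝔸 : Type} [NormedRing 𝔸] [NormedAlgebra ℂ 𝔸] [CompleteSpace 𝔸]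
variable {ι : Type} [Fintype ι] [DecidableEq ι]
variable (i : KIdx d ℓ hd hL b₀ b₁) (b : Module.Basis ι ℝ 𝔸)
variable [Fintype (geo9K i).Site] [DecidableEq (geo9K i).Site] {Rr : ℝ} {Hp : Prop}
variable (ιB : BlkY i → IBondY i)

/-! ## §1 ★★ Theorem 3.9 ⇒ the (3.48)-shape majorant of `conj b (s•C(U))`, every input per-cube and displayed -/

omit [CompleteSpace 𝔸] in
/-- ★★ **THEOREM 3.9 ⇒ THEOREM 3.2's (3.48) BLOCK FOR `C(U) = (Q′G′²Q′*)⁻¹(U)` AT def-Y's CARRIERS, FROM PER-CUBE DISPLAYED DATA** (p. 413 «This theorem implies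
Theorem 3.2»; p. 411 (3.95)–(3.96)): block letters `L` (= Q′G′²Q′*), `T` with `T·L = 1`, local letters `L_□`, `C_□`, the partition `h_□` on 𝔅 and the
cut-offs `χ_□` of (3.95) with their support / separation / slow-variation data, the local inverse property, per-cube (3.48) blocks `hC`, upper majorants
`hL`, `hLloc`, [2]-difference majorants `hD`, scale transfer, (2.54), symmetry, [4] Lemma 2.1 at `(δ₀, b−ρ)` and at `(ρδ₀, α′)`, and the smallness
`(θ₁+θ₂+θ₃)c₁(ρδ₀, α′) < 1` («M sufficiently large») ⟹ `conj b (s•T)` has the majorant `N B₀ c₁(ρδ₀,α′)(1 − (θ₁+θ₂+θ₃)c₁(ρδ₀,α′))⁻¹·P(a)·e^{−(1−α′)ρδ₀d(a,a′)}`.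
FILE 1 §4 ∘ FILE 5b (hR₁, hR₂, hR₃). [cite: Balaban1985BackgroundPropagators, Thm 3.9 p.413 + (3.95)–(3.96) p.411 + (3.87) p.409 + Thm 3.2 (3.48) p.398; Balaban1984PropagatorsII, (2.66) p.234 + (2.83)–(2.85) p.238] -/
theorem hasMajorant_conj_Cinv_final (d' : ℕ)
    {δ₀ aL aD αc αst asep ρ bb κ κD Dsep ℓ₀ ℓ₁ B₀ C N s s' α' θ₁ θ₂ θ₃ : ℝ} (P : (geo9K i).Site → ℝ)
    {κι : Type} [Fintype κι] (Sχ S : κι → Finset (geo9K i).Site) (χ h : κι → BlkY i → ℝ)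
    {L T : Module.End ℝ (BlkY i → 𝔸)} (Lloc Cl : κι → Module.End ℝ (BlkY i → 𝔸))
    -- constants and exponent bookkeeping
    (hs : s' * s = 1) (hκ : 0 ≤ κ) (hκD : 0 ≤ κD) (hℓ₀ : 0 ≤ ℓ₀) (hℓ₁ : 0 ≤ ℓ₁) (hB₀ : 0 ≤ B₀) (hC0 : 0 ≤ C) (hN : 0 ≤ N)
    (hP : ∀ a, 0 < P a) (hδ₀ : 0 ≤ δ₀) (hasep : 0 ≤ asep) (hρ : 0 ≤ ρ) (hρb : ρ ≤ bb) (hαc : 0 < αc * δ₀) (hα'1 : α' ≤ 1)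
    (hsplit₁ : αst + asep + ρ ≤ aL) (hsplit₂ : αst + ρ ≤ aD) (hsplit₃ : αst + αc + ρ ≤ aL)
    (hθ₁ : θ₁ = N * (κ * B₀ * C * B6.c1 d' δ₀ (bb - ρ) * Real.exp (-(asep * δ₀ * Dsep))))
    (hθ₂ : θ₂ = N * (κD * Real.exp (-(2 * δ₀ * Dsep)) * B₀ * C * B6.c1 d' δ₀ (bb - ρ)))
    (hθ₃ : θ₃ = N * ((ℓ₀ + ℓ₁ * (αc * δ₀)⁻¹) * κ * B₀ * C * B6.c1 d' δ₀ (bb - ρ)))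
    -- the geometry of the member ([4] (2.54), symmetry, d ≥ 0, d(a,a) = 0, scale transfer of `P`, Lemma 2.1 twice)
    (htri : Triangle254 (toB6 (geo9K i) Rr Hp)) (hrefl : ∀ y : (geo9K i).Site, (geo9K i).dist y y = 0)
    (hsymm : ∀ a a' : (geo9K i).Site, (geo9K i).dist a a' = (geo9K i).dist a' a) (hdnn : ∀ a a' : (geo9K i).Site, 0 ≤ (geo9K i).dist a a')
    (hST : B9Ineq347.ScaleTransfer (geo9K i) δ₀ αst C P) (h261b : Ineq261 d' (toB6 (geo9K i) Rr Hp) δ₀ (bb - ρ))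
    (h261 : Ineq261 d' (toB6 (geo9K i) Rr Hp) (ρ * δ₀) α') (h263 : Ineq263 d' (toB6 (geo9K i) Rr Hp) (ρ * δ₀) α')
    (hsmall : (θ₁ + θ₂ + θ₃) * B6.c1 d' (ρ * δ₀) α' < 1)
    -- the letters: inverse, partition, cut-offs, separation, slow variation, local inverse property
    (hinv : T * L = 1) (hsq : ∀ t, ∑ k, h k t ^ 2 = 1) (hh : ∀ k t, |h k t| ≤ 1) (hS : ∀ k t, h k t ≠ 0 → ιB t ∈ S k)
    (hcnt : ∀ a : (geo9K i).Site, (∑ k, if a ∈ S k then (1 : ℝ) else 0) ≤ N)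
    (hχ01 : ∀ k t, 0 ≤ χ k t ∧ χ k t ≤ 1) (hχS : ∀ k t, ιB t ∈ Sχ k → χ k t = 1)
    (hsep : ∀ k a, a ∉ Sχ k → ∀ a'' ∈ S k, Dsep ≤ (geo9K i).dist a a'')
    (hLip : ∀ k (t t' : BlkY i), |h k t' - h k t| ≤ ℓ₀ + ℓ₁ * (geo9K i).dist (ιB t) (ιB t'))
    (hloc : ∀ k, (cutMulY (𝔸 := 𝔸) (h k)).restrictScalars ℝ * ((cutMulY (𝔸 := 𝔸) (χ k)).restrictScalars ℝ * Lloc k) * Cl k *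
      (cutMulY (𝔸 := 𝔸) (h k)).restrictScalars ℝ = (cutMulY (𝔸 := 𝔸) (h k)).restrictScalars ℝ * (cutMulY (𝔸 := 𝔸) (h k)).restrictScalars ℝ)
    -- the per-cube analytic blocks (printed shapes)
    (hC : ∀ k, HasMajorant (g := toB6 (geo9K i) Rr Hp) (fun p : BlkY i × ι => ιB p.1) (conj b (s • Cl k))
      (fun a a' => if a ∈ S k then B₀ * P a * Real.exp (-(bb * δ₀ * (geo9K i).dist a a')) else 0))
    (hLmaj : HasMajorant (g := toB6 (geo9K i) Rr Hp) (fun p : BlkY i × ι => ιB p.1) (conj b (s' • L))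
      (fun a a'' => κ * (P a)⁻¹ * Real.exp (-(aL * δ₀ * (geo9K i).dist a a''))))
    (hLloc : ∀ k, HasMajorant (g := toB6 (geo9K i) Rr Hp) (fun p : BlkY i × ι => ιB p.1) (conj b (s' • Lloc k))
      (fun a a'' => κ * (P a)⁻¹ * Real.exp (-(aL * δ₀ * (geo9K i).dist a a''))))
    (hD : ∀ k, HasMajorant (g := toB6 (geo9K i) Rr Hp) (fun p : BlkY i × ι => ιB p.1) (conj b (s' • (L - Lloc k)))
      (fun a a'' => κD * Real.exp (-(2 * δ₀ * Dsep)) * (P a)⁻¹ * Real.exp (-(aD * δ₀ * (geo9K i).dist a a'')))) :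
    HasMajorant (g := toB6 (geo9K i) Rr Hp) (fun p : BlkY i × ι => ιB p.1) (conj b (s • T))
      (fun a a' => N * B₀ * B6.c1 d' (ρ * δ₀) α' * (1 - (θ₁ + θ₂ + θ₃) * B6.c1 d' (ρ * δ₀) α')⁻¹ * P a *
        Real.exp (-((1 - α') * (ρ * δ₀) * (geo9K i).dist a a'))) := by
  have hNκ : 0 ≤ N * κ := mul_nonneg hN hκ
  have hc1 : 0 ≤ B6.c1 d' δ₀ (bb - ρ) := B6RandomWalk.c1_nonneg d' δ₀ _
  have hθ₁0 : 0 ≤ θ₁ := by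
    rw [hθ₁]; exact mul_nonneg hN (mul_nonneg (mul_nonneg (mul_nonneg (mul_nonneg hκ hB₀) hC0) hc1) (Real.exp_nonneg _))
  have hθ₂0 : 0 ≤ θ₂ := by
    rw [hθ₂]; exact mul_nonneg hN (mul_nonneg (mul_nonneg (mul_nonneg (mul_nonneg hκD (Real.exp_nonneg _)) hB₀) hC0) hc1)
  have hθ₃0 : 0 ≤ θ₃ := by
    rw [hθ₃]
    exact mul_nonneg hN (mul_nonneg (mul_nonneg (mul_nonneg (mul_nonneg
      (add_nonneg hℓ₀ (mul_nonneg hℓ₁ (inv_nonneg.mpr hαc.le))) hκ) hB₀) hC0) hc1)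
  have hαr : 0 ≤ (1 - α') * (ρ * δ₀) := mul_nonneg (sub_nonneg.mpr hα'1) (mul_nonneg hρ hδ₀)
  -- the per-cube (3.48) blocks at the weaker rate `ρδ₀` (e^{−bδ₀d} ≤ e^{−ρδ₀d})
  have hC' : ∀ k, HasMajorant (g := toB6 (geo9K i) Rr Hp) (fun p : BlkY i × ι => ιB p.1) (conj b (s • Cl k))
      (fun a a' => if a ∈ S k then B₀ * P a * Real.exp (-(ρ * δ₀ * (geo9K i).dist a a')) else 0) := fun k =>
    hasMajorant_mono (g := toB6 (geo9K i) Rr Hp) _ (hC k) fun a a' => by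
      split_ifs
      · refine mul_le_mul_of_nonneg_left (Real.exp_le_exp.mpr ?_) (mul_nonneg hB₀ (hP a).le)
        have h1 := mul_le_mul_of_nonneg_right hρb (mul_nonneg hδ₀ (hdnn a a'))
        nlinarith [h1]
      · exact le_rfl
  -- the three sums (FILE 5b)
  have h1 := hR₁_of_cubes i b ιB (Rr := Rr) (Hp := Hp) d' P Sχ S χ h Cl hs hκ hB₀ hC0 hP hδ₀ hasep hρ hsplit₁ htri hsymm hdnn hST h261b hχ01 hχS
    hh hS hsep hcnt hLmaj hC
  have h2 := hR₂_of_cubes i b ιB (Rr := Rr) (Hp := Hp) d' P S χ h Lloc Cl hs hκD hB₀ hC0 hP hδ₀ hρ hsplit₂ htri hsymm hdnn hST h261b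
    (fun k t => by obtain ⟨h0, h1⟩ := hχ01 k t; rw [abs_le]; constructor <;> linarith) hh hS hcnt hD hC
  have h3 := hR₃_of_cubes i b ιB (Rr := Rr) (Hp := Hp) d' P S χ h Lloc Cl hs hκ hℓ₀ hℓ₁ hB₀ hC0 hP hδ₀ hαc hρ hsplit₃ htri hsymm hdnn hST h261b
    (fun k t => by obtain ⟨h0, h1⟩ := hχ01 k t; rw [abs_le]; constructor <;> linarith) hh hS hLip hcnt hLloc hC
  rw [← hθ₁] at h1
  rw [← hθ₂] at h2
  rw [← hθ₃] at h3
  -- FILE 1's glue at the rate `r := ρδ₀`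
  exact hasMajorant_conj_Cinv_of_cubes i b ιB d' P s S h (fun k => (cutMulY (𝔸 := 𝔸) (χ k)).restrictScalars ℝ) Cl Lloc hB₀ (fun a => (hP a).le) hN
    hθ₁0 hθ₂0 hθ₃0 hαr htri hrefl hdnn h261 h263 hsmall hinv hsq hh hS hcnt hloc hC' h1 h2 h3

/-! ## §2 ★★ (3.48)'s printed shape, pointwise, from the same data -/

omit [CompleteSpace 𝔸] in
/-- ★★ **THEOREM 3.2 (3.48) FOR `C(U)` POINTWISE, FROM THE PER-CUBE DATA** («|(Q′G′²Q′*)⁻¹(y, y′)| ≦ B₀(Lʲη)⁻⁴(L^{j′}η)^{−d}e^{−δ₀d(y,y′)}», the pairing weight inside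
the one-block source, `P`, `s` the level/scale weights): under the hypotheses of `hasMajorant_conj_Cinv_final` (`0 ≦ s`) and a coordinate bound `M₂` of the
basis `b`, every source `λ` supported at one block `s₀` with `‖λ(s₀)‖ ≦ 1` obeys
`s·‖(Tλ)(t)‖ ≦ (Σ_j‖b_j‖)M₂·[N B₀c₁(1 − (θ₁+θ₂+θ₃)c₁)⁻¹]·P(ιB t)·e^{−(1−α′)ρδ₀·d(ιB t, ιB s₀)}` (FILE 1's block reading `norm_apply_le_of_hasMajorant_blk`).
[cite: Balaban1985BackgroundPropagators, Thm 3.2 (3.48) p.398 via Thm 3.9 p.413; Balaban1984PropagatorsII, (2.51) p.232] -/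
theorem norm_Cinv_apply_final {M₂ : ℝ} (hM₂ : 0 ≤ M₂) (hrepr : ∀ (v : 𝔸) (j : ι), |b.repr v j| ≤ M₂ * ‖v‖) (d' : ℕ)
    {δ₀ aL aD αc αst asep ρ bb κ κD Dsep ℓ₀ ℓ₁ B₀ C N s s' α' θ₁ θ₂ θ₃ : ℝ} (P : (geo9K i).Site → ℝ)
    {κι : Type} [Fintype κι] (Sχ S : κι → Finset (geo9K i).Site) (χ h : κι → BlkY i → ℝ)
    {L T : Module.End ℝ (BlkY i → 𝔸)} (Lloc Cl : κι → Module.End ℝ (BlkY i → 𝔸))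
    (hs : s' * s = 1) (hs0 : 0 ≤ s) (hκ : 0 ≤ κ) (hκD : 0 ≤ κD) (hℓ₀ : 0 ≤ ℓ₀) (hℓ₁ : 0 ≤ ℓ₁) (hB₀ : 0 ≤ B₀) (hC0 : 0 ≤ C) (hN : 0 ≤ N)
    (hP : ∀ a, 0 < P a) (hδ₀ : 0 ≤ δ₀) (hasep : 0 ≤ asep) (hρ : 0 ≤ ρ) (hρb : ρ ≤ bb) (hαc : 0 < αc * δ₀) (hα'1 : α' ≤ 1)
    (hsplit₁ : αst + asep + ρ ≤ aL) (hsplit₂ : αst + ρ ≤ aD) (hsplit₃ : αst + αc + ρ ≤ aL)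
    (hθ₁ : θ₁ = N * (κ * B₀ * C * B6.c1 d' δ₀ (bb - ρ) * Real.exp (-(asep * δ₀ * Dsep))))
    (hθ₂ : θ₂ = N * (κD * Real.exp (-(2 * δ₀ * Dsep)) * B₀ * C * B6.c1 d' δ₀ (bb - ρ)))
    (hθ₃ : θ₃ = N * ((ℓ₀ + ℓ₁ * (αc * δ₀)⁻¹) * κ * B₀ * C * B6.c1 d' δ₀ (bb - ρ)))
    (htri : Triangle254 (toB6 (geo9K i) Rr Hp)) (hrefl : ∀ y : (geo9K i).Site, (geo9K i).dist y y = 0)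
    (hsymm : ∀ a a' : (geo9K i).Site, (geo9K i).dist a a' = (geo9K i).dist a' a) (hdnn : ∀ a a' : (geo9K i).Site, 0 ≤ (geo9K i).dist a a')
    (hST : B9Ineq347.ScaleTransfer (geo9K i) δ₀ αst C P) (h261b : Ineq261 d' (toB6 (geo9K i) Rr Hp) δ₀ (bb - ρ))
    (h261 : Ineq261 d' (toB6 (geo9K i) Rr Hp) (ρ * δ₀) α') (h263 : Ineq263 d' (toB6 (geo9K i) Rr Hp) (ρ * δ₀) α')
    (hsmall : (θ₁ + θ₂ + θ₃) * B6.c1 d' (ρ * δ₀) α' < 1)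
    (hinv : T * L = 1) (hsq : ∀ t, ∑ k, h k t ^ 2 = 1) (hh : ∀ k t, |h k t| ≤ 1) (hS : ∀ k t, h k t ≠ 0 → ιB t ∈ S k)
    (hcnt : ∀ a : (geo9K i).Site, (∑ k, if a ∈ S k then (1 : ℝ) else 0) ≤ N)
    (hχ01 : ∀ k t, 0 ≤ χ k t ∧ χ k t ≤ 1) (hχS : ∀ k t, ιB t ∈ Sχ k → χ k t = 1)
    (hsep : ∀ k a, a ∉ Sχ k → ∀ a'' ∈ S k, Dsep ≤ (geo9K i).dist a a'')
    (hLip : ∀ k (t t' : BlkY i), |h k t' - h k t| ≤ ℓ₀ + ℓ₁ * (geo9K i).dist (ιB t) (ιB t'))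
    (hloc : ∀ k, (cutMulY (𝔸 := 𝔸) (h k)).restrictScalars ℝ * ((cutMulY (𝔸 := 𝔸) (χ k)).restrictScalars ℝ * Lloc k) * Cl k *
      (cutMulY (𝔸 := 𝔸) (h k)).restrictScalars ℝ = (cutMulY (𝔸 := 𝔸) (h k)).restrictScalars ℝ * (cutMulY (𝔸 := 𝔸) (h k)).restrictScalars ℝ)
    (hC : ∀ k, HasMajorant (g := toB6 (geo9K i) Rr Hp) (fun p : BlkY i × ι => ιB p.1) (conj b (s • Cl k))
      (fun a a' => if a ∈ S k then B₀ * P a * Real.exp (-(bb * δ₀ * (geo9K i).dist a a')) else 0))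
    (hLmaj : HasMajorant (g := toB6 (geo9K i) Rr Hp) (fun p : BlkY i × ι => ιB p.1) (conj b (s' • L))
      (fun a a'' => κ * (P a)⁻¹ * Real.exp (-(aL * δ₀ * (geo9K i).dist a a''))))
    (hLloc : ∀ k, HasMajorant (g := toB6 (geo9K i) Rr Hp) (fun p : BlkY i × ι => ιB p.1) (conj b (s' • Lloc k))
      (fun a a'' => κ * (P a)⁻¹ * Real.exp (-(aL * δ₀ * (geo9K i).dist a a''))))
    (hD : ∀ k, HasMajorant (g := toB6 (geo9K i) Rr Hp) (fun p : BlkY i × ι => ιB p.1) (conj b (s' • (L - Lloc k)))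
      (fun a a'' => κD * Real.exp (-(2 * δ₀ * Dsep)) * (P a)⁻¹ * Real.exp (-(aD * δ₀ * (geo9K i).dist a a''))))
    (lam : BlkY i → 𝔸) (s₀ : BlkY i) (hsupp : ∀ t, t ≠ s₀ → lam t = 0) (hbd : ‖lam s₀‖ ≤ 1) (t : BlkY i) :
    s * ‖T lam t‖ ≤ (∑ j, ‖b j‖) * M₂ * (N * B₀ * B6.c1 d' (ρ * δ₀) α' * (1 - (θ₁ + θ₂ + θ₃) * B6.c1 d' (ρ * δ₀) α')⁻¹) * P (ιB t) *
      Real.exp (-((1 - α') * (ρ * δ₀) * (geo9K i).dist (ιB t) (ιB s₀))) := by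
  have hmaj := hasMajorant_conj_Cinv_final i b ιB (Rr := Rr) (Hp := Hp) d' P Sχ S χ h Lloc Cl hs hκ hκD hℓ₀ hℓ₁ hB₀ hC0 hN hP hδ₀ hasep hρ hρb hαc
    hα'1 hsplit₁ hsplit₂ hsplit₃ hθ₁ hθ₂ hθ₃ htri hrefl hsymm hdnn hST h261b h261 h263 hsmall hinv hsq hh hS hcnt hχ01 hχS hsep hLip hloc hC hLmaj
    hLloc hD
  have hw := norm_apply_le_of_hasMajorant_blk i b ιB (s • T) hM₂ hrepr hmaj lam s₀ zero_le_one hsupp hbd t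
  rw [LinearMap.smul_apply, Pi.smul_apply, norm_smul, Real.norm_eq_abs, abs_of_nonneg hs0] at hw
  exact hw.trans (le_of_eq (by ring))

/-! ## §3 At def-Y's letters: `T := XinvY`, `L := XY`, `L_□ := XY` of the cube letter; the upper majorants from SITE majorants by FILE 3b -/

section Member

variable (parS : SiteParY 𝔸 i) (Gp : SiteOpY 𝔸 i) (U : CfgY 𝔸 i)

omit [DecidableEq ι] [Fintype (geo9K i).Site] [DecidableEq (geo9K i).Site] in
/-- **`XinvY·XY = 1` on real scalars** where `Q′G′²Q′*(U)` is a unit (def-Y's `XinvY := Ring.inverse XY`; Thm 3.2's regime — the invertibility is the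
displayed hypothesis `hunit`, at the members of record w1's `isUnit_XY_parSymY`). [cite: Balaban1985BackgroundPropagators, (3.25) p.395 + Thm 3.2 p.398] -/
theorem restrictScalars_XinvY_mul_XY (hunit : IsUnit (XY i parS Gp U)) :
    (XinvY i parS Gp U).restrictScalars ℝ * (XY i parS Gp U).restrictScalars ℝ = 1 := by
  have h1 : XinvY i parS Gp U * XY i parS Gp U = 1 := Ring.inverse_mul_cancel _ hunit
  apply LinearMap.ext
  intro Λ
  rw [Module.End.mul_apply, LinearMap.restrictScalars_apply, LinearMap.restrictScalars_apply, ← Module.End.mul_apply, h1,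
    Module.End.one_apply, Module.End.one_apply]

/-- ★★ **THEOREM 3.9 ⇒ (3.48)-SHAPE MAJORANT OF `conj b (s•(Q′G′²Q′*)⁻¹(U))` AT def-Y's LETTERS** — §1 with `L := XY i parS G′ U`, `T := XinvY i parS G′ U`
(`IsUnit XY`), `L_□ := XY i parS G′_□ U` for a family of cube site-letters `G′_□ = Oc □`, and the upper majorants DISCHARGED by FILE 3b
(`hasMajorant_conj_XY_of_site`) from SITE majorants `κ_G·ℓ-weight⁻¹·e^{−a_Lδ₀d}` of `conj b (s′•(G′·G′))` and `conj b (s′•(G′_□·G′_□))` (M5.5's (3.42)₁ +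
FILE 3a shapes; contractive transporters `hpar`, coordinate bound `M₂`; `κ = (M₂Σ_j‖b_j‖)²κ_G`); the [2]-difference majorants `hD` of
`conj b (s′•(XY G′ − XY G′_□))`, the per-cube `hC`, `hloc` and the geometry stay displayed.
[cite: Balaban1985BackgroundPropagators, Thm 3.9 p.413 + (3.95)–(3.96) p.411 + (3.21)/(3.25) pp.394–395 + Thm 3.2 (3.48) p.398] -/
theorem hasMajorant_conj_XinvY_final (hunit : IsUnit (XY i parS Gp U))
    (hpar : ∀ z w : SiteY i, ‖(parS U z w : 𝔸)‖ ≤ 1 ∧ ‖(((parS U z w)⁻¹ : 𝔸ˣ) : 𝔸)‖ ≤ 1)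
    {M₂ : ℝ} (hM₂ : 0 ≤ M₂) (hrepr : ∀ (v : 𝔸) (j : ι), |b.repr v j| ≤ M₂ * ‖v‖) (d' : ℕ)
    {δ₀ aL aD αc αst asep ρ bb κG κD Dsep ℓ₀ ℓ₁ B₀ C N s s' α' θ₁ θ₂ θ₃ : ℝ} (P : (geo9K i).Site → ℝ)
    {κι : Type} [Fintype κι] (Sχ S : κι → Finset (geo9K i).Site) (χ h : κι → BlkY i → ℝ)
    (Oc : κι → SiteOpY 𝔸 i) (Cl : κι → Module.End ℝ (BlkY i → 𝔸))
    (hs : s' * s = 1) (hκG : 0 ≤ κG) (hκD : 0 ≤ κD) (hℓ₀ : 0 ≤ ℓ₀) (hℓ₁ : 0 ≤ ℓ₁) (hB₀ : 0 ≤ B₀) (hC0 : 0 ≤ C) (hN : 0 ≤ N)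
    (hP : ∀ a, 0 < P a) (hδ₀ : 0 ≤ δ₀) (hasep : 0 ≤ asep) (hρ : 0 ≤ ρ) (hρb : ρ ≤ bb) (hαc : 0 < αc * δ₀) (hα'1 : α' ≤ 1)
    (hsplit₁ : αst + asep + ρ ≤ aL) (hsplit₂ : αst + ρ ≤ aD) (hsplit₃ : αst + αc + ρ ≤ aL)
    (hθ₁ : θ₁ = N * (((M₂ * ∑ j, ‖b j‖) ^ 2 * κG) * B₀ * C * B6.c1 d' δ₀ (bb - ρ) * Real.exp (-(asep * δ₀ * Dsep))))
    (hθ₂ : θ₂ = N * (κD * Real.exp (-(2 * δ₀ * Dsep)) * B₀ * C * B6.c1 d' δ₀ (bb - ρ)))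
    (hθ₃ : θ₃ = N * ((ℓ₀ + ℓ₁ * (αc * δ₀)⁻¹) * ((M₂ * ∑ j, ‖b j‖) ^ 2 * κG) * B₀ * C * B6.c1 d' δ₀ (bb - ρ)))
    (htri : Triangle254 (toB6 (geo9K i) Rr Hp)) (hrefl : ∀ y : (geo9K i).Site, (geo9K i).dist y y = 0)
    (hsymm : ∀ a a' : (geo9K i).Site, (geo9K i).dist a a' = (geo9K i).dist a' a) (hdnn : ∀ a a' : (geo9K i).Site, 0 ≤ (geo9K i).dist a a')
    (hST : B9Ineq347.ScaleTransfer (geo9K i) δ₀ αst C P) (h261b : Ineq261 d' (toB6 (geo9K i) Rr Hp) δ₀ (bb - ρ))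
    (h261 : Ineq261 d' (toB6 (geo9K i) Rr Hp) (ρ * δ₀) α') (h263 : Ineq263 d' (toB6 (geo9K i) Rr Hp) (ρ * δ₀) α')
    (hsmall : (θ₁ + θ₂ + θ₃) * B6.c1 d' (ρ * δ₀) α' < 1)
    (hsq : ∀ t, ∑ k, h k t ^ 2 = 1) (hh : ∀ k t, |h k t| ≤ 1) (hS : ∀ k t, h k t ≠ 0 → ιB t ∈ S k)
    (hcnt : ∀ a : (geo9K i).Site, (∑ k, if a ∈ S k then (1 : ℝ) else 0) ≤ N)
    (hχ01 : ∀ k t, 0 ≤ χ k t ∧ χ k t ≤ 1) (hχS : ∀ k t, ιB t ∈ Sχ k → χ k t = 1)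
    (hsep : ∀ k a, a ∉ Sχ k → ∀ a'' ∈ S k, Dsep ≤ (geo9K i).dist a a'')
    (hLip : ∀ k (t t' : BlkY i), |h k t' - h k t| ≤ ℓ₀ + ℓ₁ * (geo9K i).dist (ιB t) (ιB t'))
    (hloc : ∀ k, (cutMulY (𝔸 := 𝔸) (h k)).restrictScalars ℝ *
      ((cutMulY (𝔸 := 𝔸) (χ k)).restrictScalars ℝ * (XY i parS (Oc k) U).restrictScalars ℝ) * Cl k * (cutMulY (𝔸 := 𝔸) (h k)).restrictScalars ℝ =
      (cutMulY (𝔸 := 𝔸) (h k)).restrictScalars ℝ * (cutMulY (𝔸 := 𝔸) (h k)).restrictScalars ℝ)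
    (hC : ∀ k, HasMajorant (g := toB6 (geo9K i) Rr Hp) (fun p : BlkY i × ι => ιB p.1) (conj b (s • Cl k))
      (fun a a' => if a ∈ S k then B₀ * P a * Real.exp (-(bb * δ₀ * (geo9K i).dist a a')) else 0))
    (hGG : HasMajorant (g := toB6 (geo9K i) Rr Hp) (fun p : SiteY i × ι => ιB (B6Geom246MultiLevelBox.blkOf i.D.toDomains p.1))
      (conj b (s' • ((Gp U).restrictScalars ℝ * (Gp U).restrictScalars ℝ)))
      (fun a a'' => κG * (P a)⁻¹ * Real.exp (-(aL * δ₀ * (geo9K i).dist a a''))))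
    (hGGc : ∀ k, HasMajorant (g := toB6 (geo9K i) Rr Hp) (fun p : SiteY i × ι => ιB (B6Geom246MultiLevelBox.blkOf i.D.toDomains p.1))
      (conj b (s' • ((Oc k U).restrictScalars ℝ * (Oc k U).restrictScalars ℝ)))
      (fun a a'' => κG * (P a)⁻¹ * Real.exp (-(aL * δ₀ * (geo9K i).dist a a''))))
    (hD : ∀ k, HasMajorant (g := toB6 (geo9K i) Rr Hp) (fun p : BlkY i × ι => ιB p.1)
      (conj b (s' • ((XY i parS Gp U).restrictScalars ℝ - (XY i parS (Oc k) U).restrictScalars ℝ)))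
      (fun a a'' => κD * Real.exp (-(2 * δ₀ * Dsep)) * (P a)⁻¹ * Real.exp (-(aD * δ₀ * (geo9K i).dist a a'')))) :
    HasMajorant (g := toB6 (geo9K i) Rr Hp) (fun p : BlkY i × ι => ιB p.1) (conj b (s • (XinvY i parS Gp U).restrictScalars ℝ))
      (fun a a' => N * B₀ * B6.c1 d' (ρ * δ₀) α' * (1 - (θ₁ + θ₂ + θ₃) * B6.c1 d' (ρ * δ₀) α')⁻¹ * P a *
        Real.exp (-((1 - α') * (ρ * δ₀) * (geo9K i).dist a a'))) := by
  have hK : ∀ a a'' : (geo9K i).Site, 0 ≤ κG * (P a)⁻¹ * Real.exp (-(aL * δ₀ * (geo9K i).dist a a'')) := fun a a'' =>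
    mul_nonneg (mul_nonneg hκG (inv_nonneg.mpr (hP a).le)) (Real.exp_nonneg _)
  -- the upper majorants of `L = XY G′` and `L_□ = XY G′_□` from the site majorants (FILE 3b)
  have hLmaj : HasMajorant (g := toB6 (geo9K i) Rr Hp) (fun p : BlkY i × ι => ιB p.1) (conj b (s' • (XY i parS Gp U).restrictScalars ℝ))
      (fun a a'' => ((M₂ * ∑ j, ‖b j‖) ^ 2 * κG) * (P a)⁻¹ * Real.exp (-(aL * δ₀ * (geo9K i).dist a a''))) :=
    hasMajorant_mono (g := toB6 (geo9K i) Rr Hp) _ (hasMajorant_conj_XY_of_site i b ιB parS Gp U hpar hM₂ hrepr s' hK hGG)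
      fun a a'' => le_of_eq (by ring)
  have hLloc : ∀ k, HasMajorant (g := toB6 (geo9K i) Rr Hp) (fun p : BlkY i × ι => ιB p.1)
      (conj b (s' • (XY i parS (Oc k) U).restrictScalars ℝ))
      (fun a a'' => ((M₂ * ∑ j, ‖b j‖) ^ 2 * κG) * (P a)⁻¹ * Real.exp (-(aL * δ₀ * (geo9K i).dist a a''))) := fun k =>
    hasMajorant_mono (g := toB6 (geo9K i) Rr Hp) _ (hasMajorant_conj_XY_of_site i b ιB parS (Oc k) U hpar hM₂ hrepr s' hK (hGGc k))
      fun a a'' => le_of_eq (by ring)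
  exact hasMajorant_conj_Cinv_final i b ιB d' P Sχ S χ h (fun k => (XY i parS (Oc k) U).restrictScalars ℝ) Cl hs
    (mul_nonneg (sq_nonneg _) hκG) hκD hℓ₀ hℓ₁ hB₀ hC0 hN hP hδ₀ hasep hρ hρb hαc hα'1 hsplit₁ hsplit₂ hsplit₃ hθ₁ hθ₂ hθ₃ htri hrefl hsymm hdnn hST
    h261b h261 h263 hsmall (restrictScalars_XinvY_mul_XY i parS Gp U hunit) hsq hh hS hcnt hχ01 hχS hsep hLip hloc hC hLmaj hLloc hD

end Member

end Literature.MathematicalPhysics.QuantumFieldTheory.Balaban1983to89.B9Thm39CinvTorusRegularFinal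

end
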